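import Literature.Analysis.Fourier.FiniteUncertaintyPrinciple
import HarnessLib

/-!
# Tao's uncertainty principle for `ℤ/p`: proof of Theorem 1 (discharge of `tao2005_uncertainty_prime`)

Analysis/Fourier proof file; sibling of `FiniteUncertaintyPrinciple` (the named fact
`Literature.Analysis.Fourier.tao2005_uncertainty_prime`: for a prime `p`, (i) every non-zero
`f : ℤ/p → ℂ` has `|supp f| + |supp 𝓕f| ≥ p + 1`, (ii) for non-empty `A, B ⊆ ℤ/p` with
`|A| + |B| ≥ p + 1` some `f` has `supp f = A`, `supp 𝓕f = B` [Tao2005, Theorem 1]). This file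
PROVES it: `tao2005_uncertainty_prime_holds`, following T. Tao, *An uncertainty principle for
cyclic groups of prime order*, Math. Res. Lett. 12 (2005) 121–127 = arXiv:math/0308286, §1
(held: paper:arxiv-math_0308286, pp. 3–4 read).

## The argument (as formalised)

* **Lemma 2** (Galois step), single-variable form `int_dvd_eval_one_of_aeval_primitiveRoot_eq_zero`:
  an integer polynomial vanishing at a primitive `p`-th root of unity `ω` is a multiple of the
  cyclotomic polynomial (`Polynomial.cyclotomic_eq_minpoly`, `minpoly.isIntegrallyClosed_dvd`),
  so its value at `1` is a multiple of `Φ_p(1) = p`.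
* **Lemma 3** (Chebotarev: all minors of `(ω^{jk})` are non-zero),
  `det_primitiveRoot_pow_mul_ne_zero`. DEVIATION from the printed proof, which factors the
  `n`-variable polynomial `D(z) = det(z_j^{ξ_k}) = P(z)·∏(z_j - z_{j'})` and computes `P(1,…,1)`
  with the differential operators `(z_j d/dz_j)^{j-1}` (multivariate Leibniz bookkeeping absent
  from Mathlib). We factor the MATRIX instead, over `ℤ[X]` with nodes `y_j = X^{b_j}`: the
  division-free Newton (divided-difference) expansion
  `t^a = ∑_{k+m=a} h_m(y_0,…,y_k) ∏_{l<k}(t - y_l)` (`pow_eq_sum_completeHomogeneous_mul_newton`,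
  with the complete homogeneous polynomials given by their recursion,
  `exists_completeHomogeneous_table`) yields `(y_j^{a_i}) = D · V` with `V` upper triangular,
  `det V = ∏_{l<k}(y_k - y_l)` (`pow_matrix_eq_completeHomogeneous_mul_newton`, `det_newton_matrix`).
  At `X = ω` the factor `det V(ω) ≠ 0` (distinct roots of unity), so a vanishing minor forces
  `det D(ω) = 0`, whence `p ∣ det D(1)` by Lemma 2; but `D(1) = (C(a_i,k))_{i,k}` (Pascal,
  `completeHomogeneous_table_ones`) and `(∏_k k!)·det(C(a_i,k)) = det Vandermonde(a) =
  ∏_{i<i'}(a_{i'} - a_i) ≢ 0 (mod p)` (`superfactorial_mul_det_choose_eq_det_vandermonde`, as in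
  Mathlib's `Matrix.superFactorial_dvd_vandermonde_det`; `det_choose_ne_zero_mod`) — the same
  integer as the paper's `(n-1)!⋯0!·P(1,…,1) = ± ∏(ξ_k - ξ_{k'})`.
* **Corollary 4** for Mathlib's kernel `ZMod.stdAddChar (-(x ξ)) = ω^{(-ξ).val · x.val}`,
  `ω = stdAddChar 1 = e^{2πi/p}` (`det_dftMinor_ne_zero`).
* **Theorem 1 (i)** `tao2005_card_support_add_card_support_dft`: if `|supp f| + |supp 𝓕f| ≤ p`,
  pick `|supp f|` zeros of `𝓕f`; the corresponding minor kills `f|_{supp f}`, contradiction.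
* **Theorem 1 (ii)**: for `|A| + |B| ≥ p + 1` the restricted Fourier matrix `ℓ²(A) → ℓ²(Bᶜ)` has a
  kernel (`LinearMap.ker_ne_bot_of_finrank_lt`; `exists_ne_zero_supported_dft_supported`); when
  `|A| + |B| = p + 1` part (i) forces the supports to be exactly `A`, `B`
  (`exists_support_eq_of_card_add_card_eq`); in general ("generic linear combinations") the
  evaluation functionals `f ↦ f(x)` (`x ∈ A`) and `f ↦ 𝓕f(ξ)` (`ξ ∈ B`) are non-zero on the space of
  admissible `f`, and finitely many non-zero functionals over `ℂ` have a common non-vanishing point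
  (`exists_forall_apply_ne_zero`), giving `tao2005_exists_support_eq`.

## References

* T. Tao, Math. Res. Lett. 12 (2005) 121–127 = arXiv:math/0308286: §1 Lemma 2, Lemma 3,
  Corollary 4, **Theorem 1**. [Tao2005]
-/

noncomputable section

open Finset

namespace Literature.Analysis.Fourier

/-! ### Chebotarev's lemma (Tao 2005, Lemmas 2–3): algebraic core -/

section NewtonFactorisation

variable {R : Type*} [CommRing R]

/-- Existence of the table of complete homogeneous polynomials `H k m = h_m(y_0,…,y_{k-1})` in the
leading nodes, characterised by `h_{m+1}() = 0`, `h_0 = 1` and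
`h_{m+1}(y_0..y_k) = h_{m+1}(y_0..y_{k-1}) + y_k · h_m(y_0..y_k)`. [folklore] -/
theorem exists_completeHomogeneous_table (y : ℕ → R) :
    ∃ H : ℕ → ℕ → R, (∀ m, H 0 (m + 1) = 0) ∧ (∀ k, H k 0 = 1) ∧
      ∀ k m, H (k + 1) (m + 1) = H k (m + 1) + y k * H (k + 1) m := by
  refine ⟨fun k => Nat.rec (motive := fun _ => ℕ → R) (fun m => if m = 0 then 1 else 0)
    (fun k Hk m => Nat.rec (motive := fun _ => R) 1 (fun m prev => Hk (m + 1) + y k * prev) m) k,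
    ?_, ?_, ?_⟩
  · intro m
    simp
  · intro k
    cases k with
    | zero => simp
    | succ k => rfl
  · intro k m
    rfl

/-- **Division-free Newton expansion of powers** (divided differences of `t ↦ t^a` at the nodes
`y_0, y_1, …` are complete homogeneous polynomials):
`t^a = ∑_{k+m=a} h_m(y_0,…,y_k) ∏_{l<k} (t - y_l)`. [folklore] -/
theorem pow_eq_sum_completeHomogeneous_mul_newton (y : ℕ → R) (H : ℕ → ℕ → R)
    (h0 : ∀ m, H 0 (m + 1) = 0) (h1 : ∀ k, H k 0 = 1)
    (hrec : ∀ k m, H (k + 1) (m + 1) = H k (m + 1) + y k * H (k + 1) m) (t : R) (a : ℕ) :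
    t ^ a = ∑ q ∈ antidiagonal a, H (q.1 + 1) q.2 * ∏ l ∈ range q.1, (t - y l) := by
  induction a with
  | zero => simp [h1]
  | succ a ih =>
    have hN : ∀ k, t * ∏ l ∈ range k, (t - y l) =
        ∏ l ∈ range (k + 1), (t - y l) + y k * ∏ l ∈ range k, (t - y l) := by
      intro k
      rw [Finset.prod_range_succ]
      ring
    have e1 : ∑ q ∈ antidiagonal (a + 1), H q.1 q.2 * ∏ l ∈ range q.1, (t - y l)
        = ∑ q ∈ antidiagonal a, H (q.1 + 1) q.2 * ∏ l ∈ range (q.1 + 1), (t - y l) := by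
      rw [Finset.Nat.sum_antidiagonal_succ]
      simp only [h0, zero_mul, zero_add]
    have e2 : ∑ q ∈ antidiagonal (a + 1), H q.1 q.2 * ∏ l ∈ range q.1, (t - y l)
        = ∏ l ∈ range (a + 1), (t - y l) +
          ∑ q ∈ antidiagonal a, H q.1 (q.2 + 1) * ∏ l ∈ range q.1, (t - y l) := by
      rw [Finset.Nat.sum_antidiagonal_succ']
      simp only [h1, one_mul]
    rw [Finset.Nat.sum_antidiagonal_succ']
    simp only [h1, one_mul, hrec, add_mul, Finset.sum_add_distrib]
    rw [pow_succ, ih, Finset.sum_mul]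
    have h3 : ∀ q ∈ antidiagonal a, H (q.1 + 1) q.2 * (∏ l ∈ range q.1, (t - y l)) * t
        = H (q.1 + 1) q.2 * ∏ l ∈ range (q.1 + 1), (t - y l) +
          y q.1 * H (q.1 + 1) q.2 * ∏ l ∈ range q.1, (t - y l) := by
      intro q _
      rw [mul_assoc, mul_comm _ t, hN]
      ring
    rw [Finset.sum_congr rfl h3, Finset.sum_add_distrib, ← e1, e2]
    ring

/-- **Newton factorisation of a generalised Vandermonde matrix**: `(y_j^{a_i})_{i,j} = D · V`
with `D_{ik} = h_{a_i-k}(y_0,…,y_k)` and `V` the (upper-triangular) matrix of Newton basis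
polynomials `V_{kj} = ∏_{l<k}(y_j - y_l)`. [folklore] -/
theorem pow_matrix_eq_completeHomogeneous_mul_newton (y : ℕ → R) (H : ℕ → ℕ → R)
    (h0 : ∀ m, H 0 (m + 1) = 0) (h1 : ∀ k, H k 0 = 1)
    (hrec : ∀ k m, H (k + 1) (m + 1) = H k (m + 1) + y k * H (k + 1) m)
    {n : ℕ} (a : Fin n → ℕ) :
    (Matrix.of fun i j : Fin n => y j ^ a i) =
      (Matrix.of fun i k : Fin n => if (k : ℕ) ≤ a i then H (k + 1) (a i - k) else 0) *
        (Matrix.of fun k j : Fin n => ∏ l ∈ range k, (y j - y l)) := by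
  ext i j
  simp only [Matrix.mul_apply, Matrix.of_apply]
  set f : ℕ → R := fun k =>
    (if k ≤ a i then H (k + 1) (a i - k) else 0) * ∏ l ∈ range k, (y j - y l) with hf
  have hvan : ∀ k, min (a i) j < k → f k = 0 := by
    intro k hk
    rcases lt_or_ge (a i) k with h | h
    · simp [hf, not_le.mpr h]
    · have hjk : (j : ℕ) < k := by omega
      have : ∏ l ∈ range k, (y j - y l) = 0 :=
        Finset.prod_eq_zero (mem_range.mpr hjk) (sub_self _)
      simp [hf, this]
  have hext : ∀ M, min (a i) j + 1 ≤ M →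
      ∑ k ∈ range (min (a i) j + 1), f k = ∑ k ∈ range M, f k := by
    intro M hM
    apply Finset.sum_subset (range_subset_range.mpr hM)
    intro k hk hk'
    apply hvan
    simp only [mem_range, not_lt] at hk hk'
    omega
  have hL : y j ^ a i = ∑ k ∈ range (a i + 1), f k := by
    rw [pow_eq_sum_completeHomogeneous_mul_newton y H h0 h1 hrec (y j) (a i),
      Finset.Nat.sum_antidiagonal_eq_sum_range_succ_mk]
    refine Finset.sum_congr rfl fun k hk => ?_
    simp [hf, Nat.lt_succ_iff.mp (mem_range.mp hk)]
  have hR : ∑ k : Fin n, (if (k : ℕ) ≤ a i then H (k + 1) (a i - k) else 0) *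
      ∏ l ∈ range k, (y j - y l) = ∑ k ∈ range n, f k :=
    Fin.sum_univ_eq_sum_range f n
  rw [hR, hL, ← hext (a i + 1) (by omega), ← hext n (by omega)]

/-- The Newton basis matrix `V_{kj} = ∏_{l<k}(y_j - y_l)` is upper triangular with determinant
`∏_k ∏_{l<k} (y_k - y_l)`. [folklore] -/
theorem det_newton_matrix (y : ℕ → R) (n : ℕ) :
    (Matrix.of fun k j : Fin n => ∏ l ∈ range k, (y j - y l)).det =
      ∏ k : Fin n, ∏ l ∈ range k, (y k - y l) := by
  rw [Matrix.det_of_upperTriangular]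
  · rfl
  · intro k j hkj
    have hkj' : (j : ℕ) < k := hkj
    exact Finset.prod_eq_zero (mem_range.mpr hkj') (sub_self _)

/-- With all nodes equal to `1` the table is Pascal's triangle: `h_m(1,…,1) = C(m+k,k)` for `k+1`
ones. [folklore] -/
theorem completeHomogeneous_table_ones {S : Type*} [CommRing S] (G : ℕ → ℕ → S)
    (h0 : ∀ m, G 0 (m + 1) = 0) (h1 : ∀ k, G k 0 = 1)
    (hrec : ∀ k m, G (k + 1) (m + 1) = G k (m + 1) + G (k + 1) m) :
    ∀ k m, G (k + 1) m = ((m + k).choose k : S) := by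
  intro k
  induction k with
  | zero =>
    intro m
    induction m with
    | zero => simp [h1]
    | succ m ih => rw [hrec, h0, ih]; simp
  | succ k ihk =>
    intro m
    induction m with
    | zero => simp [h1]
    | succ m ihm =>
      rw [hrec, ihk, ihm]
      have : (m + 1 + (k + 1)).choose (k + 1) =
          (m + 1 + k).choose k + (m + (k + 1)).choose (k + 1) := by
        rw [show m + 1 + (k + 1) = (m + k + 1) + 1 by omega, Nat.choose_succ_succ,
          show m + 1 + k = m + k + 1 by omega, show m + (k + 1) = m + k + 1 by omega]
      rw [this]
      push_cast
      ring

/-- `(∏_{k<n} k!) · det(C(v_i, j)) = det(descPochhammer_j(v_i))` (column scaling); cf. the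
(private) Mathlib lemma `Matrix.of_eval_descPochhammer_eq_mul_of_choose`. [folklore] -/
theorem det_descPochhammer_eq_superfactorial_mul_det_choose {n : ℕ} (v : Fin n → ℕ) :
    (Matrix.of fun i j : Fin n => (descPochhammer ℤ j).eval (v i : ℤ)).det =
    (∏ i : Fin n, Nat.factorial i) *
      (Matrix.of fun i j : Fin n => (Nat.choose (v i) j : ℤ)).det := by
  convert! Matrix.det_mul_row (fun (i : Fin n) => ((Nat.factorial (i : ℕ)) : ℤ)) _
  · rw [Matrix.of_apply, descPochhammer_eval_eq_descFactorial ℤ _ _]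
    congr
    exact Nat.descFactorial_eq_factorial_mul_choose _ _
  · rw [Nat.cast_prod]

/-- `(∏_{k<n} k!) · det(C(v_i,j))_{i,j<n} = det Vandermonde(v) = ∏_{i<j}(v_j - v_i)`. [folklore] -/
theorem superfactorial_mul_det_choose_eq_det_vandermonde {n : ℕ} (v : Fin n → ℕ) :
    ((∏ i : Fin n, Nat.factorial i : ℕ) : ℤ) *
      (Matrix.of fun i j : Fin n => (Nat.choose (v i) j : ℤ)).det =
    (Matrix.vandermonde fun i => (v i : ℤ)).det := by
  rw [Matrix.det_eval_matrixOfPolynomials_eq_det_vandermonde (fun i => (v i : ℤ))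
      (fun i => descPochhammer ℤ i) (fun i => descPochhammer_natDegree ℤ i)
      (fun i => monic_descPochhammer ℤ i),
    det_descPochhammer_eq_superfactorial_mul_det_choose]

/-- For `v` injective with values `< p`, `det(C(v_i,j)) ≢ 0 (mod p)`. [folklore] -/
theorem det_choose_ne_zero_mod {p : ℕ} [hp : Fact p.Prime] {n : ℕ} (v : Fin n → ℕ)
    (hv : Function.Injective v) (hvp : ∀ i, v i < p) :
    ¬ (p : ℤ) ∣ (Matrix.of fun i j : Fin n => (Nat.choose (v i) j : ℤ)).det := by
  intro hdvd
  have hcast : (((Matrix.of fun i j : Fin n => (Nat.choose (v i) j : ℤ)).det : ℤ) : ZMod p) = 0 :=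
    (ZMod.intCast_zmod_eq_zero_iff_dvd _ p).mpr hdvd
  have hV : ((Matrix.vandermonde fun i => (v i : ℤ)).det : ZMod p) ≠ 0 := by
    have : ((Matrix.vandermonde fun i => (v i : ℤ)).det : ZMod p) =
        (Matrix.vandermonde fun i => (v i : ZMod p)).det := by
      rw [show ((Matrix.vandermonde fun i => (v i : ℤ)).det : ZMod p) =
          (Int.castRingHom (ZMod p)) (Matrix.vandermonde fun i => (v i : ℤ)).det from rfl,
        RingHom.map_det, RingHom.mapMatrix_apply]
      congr 1
      ext i j
      simp [Matrix.vandermonde_apply]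
    rw [this, Ne, Matrix.det_vandermonde_eq_zero_iff]
    rintro ⟨i, j, hij, hne⟩
    apply hne
    apply hv
    have := (ZMod.natCast_eq_natCast_iff' (v i) (v j) p).mp hij
    rwa [Nat.mod_eq_of_lt (hvp i), Nat.mod_eq_of_lt (hvp j)] at this
  apply hV
  have := superfactorial_mul_det_choose_eq_det_vandermonde v
  rw [← this, Int.cast_mul, hcast, mul_zero]

/-- **Tao 2005, Lemma 2** (single-variable form): an integer polynomial vanishing at a primitive
`p`-th root of unity has `d(1) ≡ 0 (mod p)`. [cite: Tao2005, Lemma 2 (arXiv:math/0308286 §1)] -/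
theorem int_dvd_eval_one_of_aeval_primitiveRoot_eq_zero {p : ℕ} [hp : Fact p.Prime] {ω : ℂ}
    (hω : IsPrimitiveRoot ω p) {d : Polynomial ℤ} (hd : Polynomial.aeval ω d = 0) :
    (p : ℤ) ∣ d.eval 1 := by
  have hint : IsIntegral ℤ ω := hω.isIntegral hp.out.pos
  have hdvd : minpoly ℤ ω ∣ d := minpoly.isIntegrallyClosed_dvd hint hd
  rw [← Polynomial.cyclotomic_eq_minpoly hω hp.out.pos] at hdvd
  obtain ⟨q, rfl⟩ := hdvd
  rw [Polynomial.eval_mul, Polynomial.eval_one_cyclotomic_prime]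
  exact dvd_mul_right _ _

open Polynomial in
/-- **Chebotarev's lemma on roots of unity** (Tao 2005, Lemma 3): for a prime `p`, a primitive
`p`-th root of unity `ω ∈ ℂ` and row/column exponents `a, b : Fin n → ℕ` injective with values
`< p`, the generalised Vandermonde / DFT minor `(ω^{a_i b_j})_{i,j}` is nonsingular.
Proof via the Newton factorisation over `ℤ[X]` (nodes `X^{b_j}`), evaluation at `ω` and at `1`
(Lemma 2), and `(∏ k!)·det(C(a_i,k)) = ∏_{i<i'}(a_{i'}-a_i) ≢ 0 (mod p)` — the same integer as the
paper's `(n-1)!⋯0!·P(1,…,1) = ± Vandermonde(ξ)`. [cite: Tao2005, Lemma 3 (arXiv:math/0308286 §1)] -/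
theorem det_primitiveRoot_pow_mul_ne_zero {p : ℕ} [hp : Fact p.Prime] {ω : ℂ}
    (hω : IsPrimitiveRoot ω p) {n : ℕ} (a b : Fin n → ℕ) (ha : Function.Injective a)
    (hb : Function.Injective b) (hap : ∀ i, a i < p) (hbp : ∀ i, b i < p) :
    (Matrix.of fun i j : Fin n => ω ^ (a i * b j)).det ≠ 0 := by
  -- extend the column exponents to `ℕ` and take nodes `y_l = X^{β l}` in `ℤ[X]`
  let β : ℕ → ℕ := fun l => if h : l < n then b ⟨l, h⟩ else 0
  have hβ : ∀ j : Fin n, β j = b j := fun j => by simp [β, j.2]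
  let y : ℕ → ℤ[X] := fun l => X ^ β l
  obtain ⟨H, h0, h1, hrec⟩ := exists_completeHomogeneous_table y
  have hfac := pow_matrix_eq_completeHomogeneous_mul_newton y H h0 h1 hrec a
  set D : Matrix (Fin n) (Fin n) ℤ[X] :=
    Matrix.of fun i k : Fin n => if (k : ℕ) ≤ a i then H (k + 1) (a i - k) else 0 with hD
  set V : Matrix (Fin n) (Fin n) ℤ[X] :=
    Matrix.of fun k j : Fin n => ∏ l ∈ range k, (y j - y l) with hV
  let φ : ℤ[X] →+* ℂ := (aeval ω).toRingHom
  have hφy : ∀ l, φ (y l) = ω ^ β l := fun l => by simp [φ, y]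
  -- the complex matrix is the image of the `ℤ[X]` matrix
  have hW : (Matrix.of fun i j : Fin n => ω ^ (a i * b j)) =
      φ.mapMatrix (Matrix.of fun i j : Fin n => y j ^ a i) := by
    ext i j
    rw [RingHom.mapMatrix_apply, Matrix.map_apply, Matrix.of_apply, Matrix.of_apply, map_pow, hφy,
      hβ, ← pow_mul, mul_comm]
  -- determinant of the Newton matrix at ω is nonzero
  have hVdet : φ V.det ≠ 0 := by
    rw [hV, det_newton_matrix, map_prod]
    simp_rw [map_prod, map_sub, hφy]
    refine Finset.prod_ne_zero_iff.mpr fun k _ => Finset.prod_ne_zero_iff.mpr fun l hl => ?_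
    have hlk : l < k := mem_range.mp hl
    have hln : l < n := hlk.trans k.2
    rw [sub_ne_zero]
    intro heq
    rw [hβ k, show β l = b ⟨l, hln⟩ by simp [β, hln]] at heq
    have h1' : b k = b ⟨l, hln⟩ := hω.pow_inj (hbp k) (hbp ⟨l, hln⟩) heq
    have h2' : k = ⟨l, hln⟩ := hb h1'
    have h3' : (k : ℕ) = l := congrArg Fin.val h2'
    omega
  intro hdet
  rw [hW, hfac, ← RingHom.map_det, Matrix.det_mul, map_mul, mul_eq_zero] at hdet
  rcases hdet with hDdet | hV0
  swap
  · exact hVdet hV0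
  -- so `det D` vanishes at ω, hence `p ∣ (det D)(1)`
  have hdvd : (p : ℤ) ∣ D.det.eval 1 :=
    int_dvd_eval_one_of_aeval_primitiveRoot_eq_zero hω hDdet
  -- evaluate the table at 1: Pascal's triangle
  have hG := completeHomogeneous_table_ones (fun k m => (H k m).eval 1)
    (fun m => by simp [h0]) (fun k => by simp [h1])
    (fun k m => by simp [hrec, y])
  have hD1 : D.det.eval 1 = (Matrix.of fun i j : Fin n => (Nat.choose (a i) j : ℤ)).det := by
    rw [show D.det.eval 1 = (evalRingHom 1) D.det from rfl, RingHom.map_det, RingHom.mapMatrix_apply]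
    congr 1
    ext i k
    simp only [hD, Matrix.map_apply, Matrix.of_apply]
    split_ifs with hk
    · rw [coe_evalRingHom, hG, Nat.sub_add_cancel hk]
    · rw [map_zero, Nat.choose_eq_zero_of_lt (not_le.mp hk), Nat.cast_zero]
  rw [hD1] at hdvd
  exact det_choose_ne_zero_mod a ha hap hdvd

end NewtonFactorisation

/-! ### The DFT minors and Theorem 1 -/

section TaoTheorem

variable {p : ℕ} [hp : Fact p.Prime]

/-- `ZMod.stdAddChar 1 = e^{2πi/p}` is a primitive `p`-th root of unity. [folklore] -/
theorem isPrimitiveRoot_stdAddChar_one :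
    IsPrimitiveRoot (ZMod.stdAddChar (1 : ZMod p) : ℂ) p := by
  have h := ZMod.stdAddChar_coe (N := p) (1 : ℤ)
  simp only [Int.cast_one, mul_one] at h
  rw [h]
  exact Complex.isPrimitiveRoot_exp p hp.out.ne_zero

/-- `e(x/p) = ω^{x.val}` with `ω = e(1/p)`. [folklore] -/
theorem stdAddChar_eq_pow_val (x : ZMod p) :
    (ZMod.stdAddChar x : ℂ) = (ZMod.stdAddChar (1 : ZMod p)) ^ x.val := by
  calc (ZMod.stdAddChar x : ℂ) = ZMod.stdAddChar (x.val • (1 : ZMod p)) := by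
        rw [nsmul_one, ZMod.natCast_zmod_val]
    _ = (ZMod.stdAddChar (1 : ZMod p)) ^ x.val := AddChar.map_nsmul_eq_pow _ _ _

/-- **Tao 2005, Lemma 3 / Corollary 4 for Mathlib's DFT kernel**: for distinct points `x_j` and
distinct frequencies `ξ_i` in `ℤ/p`, the minor `(e(-x_j ξ_i / p))_{i,j}` of the matrix of
`ZMod.dft` is nonsingular. [cite: Tao2005, Lemma 3 and Corollary 4 (arXiv:math/0308286 §1)] -/
theorem det_dftMinor_ne_zero {n : ℕ} (x ξ : Fin n → ZMod p)
    (hx : Function.Injective x) (hξ : Function.Injective ξ) :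
    (Matrix.of fun i j : Fin n => (ZMod.stdAddChar (-(x j * ξ i)) : ℂ)).det ≠ 0 := by
  have hω : IsPrimitiveRoot (ZMod.stdAddChar (1 : ZMod p) : ℂ) p := isPrimitiveRoot_stdAddChar_one
  have hmod : ∀ m : ℕ, (ZMod.stdAddChar (1 : ZMod p) : ℂ) ^ (m % p) =
      (ZMod.stdAddChar (1 : ZMod p) : ℂ) ^ m := fun m => by
    conv_rhs => rw [← Nat.mod_add_div m p, pow_add, pow_mul, hω.pow_eq_one, one_pow, mul_one]
  have hentry : ∀ i j, (ZMod.stdAddChar (-(x j * ξ i)) : ℂ) =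
      (ZMod.stdAddChar (1 : ZMod p) : ℂ) ^ ((-ξ i).val * (x j).val) := by
    intro i j
    rw [show -(x j * ξ i) = (-ξ i) * x j by ring, stdAddChar_eq_pow_val, ZMod.val_mul, hmod]
  have heq : (Matrix.of fun i j : Fin n => (ZMod.stdAddChar (-(x j * ξ i)) : ℂ)) =
      Matrix.of fun i j : Fin n =>
        (ZMod.stdAddChar (1 : ZMod p) : ℂ) ^ ((fun i => (-ξ i).val) i * (fun j => (x j).val) j) := by
    ext i j
    simp only [Matrix.of_apply, hentry]
  rw [heq]
  apply det_primitiveRoot_pow_mul_ne_zero hω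
  · intro i i' h
    exact hξ (neg_injective ((ZMod.val_injective p) h))
  · intro j j' h
    exact hx (ZMod.val_injective p h)
  · exact fun i => ZMod.val_lt _
  · exact fun j => ZMod.val_lt _

/-- Membership in the support. [folklore] -/
theorem mem_zmodSupport {N : ℕ} [NeZero N] (f : ZMod N → ℂ) (x : ZMod N) :
    x ∈ zmodSupport f ↔ f x ≠ 0 := by
  simp [zmodSupport]

/-- **Tao 2005, Theorem 1, first part**: a non-zero `f : ℤ/p → ℂ` has
`|supp f| + |supp 𝓕f| ≥ p + 1` (kernel-vector argument with the minor of Corollary 4).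
[cite: Tao2005, Theorem 1 (arXiv:math/0308286 §1)] -/
theorem tao2005_card_support_add_card_support_dft (f : ZMod p → ℂ) (hf : f ≠ 0) :
    p + 1 ≤ (zmodSupport f).card + (zmodSupport (ZMod.dft f)).card := by
  by_contra hlt
  rw [not_le] at hlt
  set A := zmodSupport f with hAdef
  set S := zmodSupport (ZMod.dft f) with hSdef
  have hA : A.Nonempty := by
    rw [Finset.nonempty_iff_ne_empty, Ne, hAdef, zmodSupport_eq_empty_iff]
    exact hf
  have hZ : A.card ≤ (Sᶜ).card := by
    rw [Finset.card_compl, ZMod.card]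
    omega
  obtain ⟨B, hBZ, hBcard⟩ := Finset.exists_subset_card_eq hZ
  set n := A.card with hndef
  let eA : A ≃ Fin n := A.equivFin
  let eB : B ≃ Fin n := B.equivFin.trans (finCongr hBcard)
  let x : Fin n → ZMod p := fun j => (eA.symm j : ZMod p)
  let ξ : Fin n → ZMod p := fun i => (eB.symm i : ZMod p)
  have hx : Function.Injective x := Subtype.val_injective.comp eA.symm.injective
  have hξ : Function.Injective ξ := Subtype.val_injective.comp eB.symm.injective
  have hdet := det_dftMinor_ne_zero x ξ hx hξ
  have hker : (Matrix.of fun i j : Fin n => (ZMod.stdAddChar (-(x j * ξ i)) : ℂ)).mulVec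
      (fun j => f (x j)) = 0 := by
    ext i
    have hξi : ZMod.dft f (ξ i) = 0 := by
      have hmem : ξ i ∈ Sᶜ := hBZ (eB.symm i).2
      rw [Finset.mem_compl, hSdef, mem_zmodSupport, not_not] at hmem
      exact hmem
    rw [ZMod.dft_apply] at hξi
    simp only [Matrix.mulVec, dotProduct, Matrix.of_apply, Pi.zero_apply]
    calc ∑ j : Fin n, ZMod.stdAddChar (-(x j * ξ i)) * f (x j)
        = ∑ j : A, ZMod.stdAddChar (-((j : ZMod p) * ξ i)) • f j :=
          Equiv.sum_comp eA.symm (fun j : A => ZMod.stdAddChar (-((j : ZMod p) * ξ i)) • f j)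
      _ = ∑ j ∈ A, ZMod.stdAddChar (-(j * ξ i)) • f j :=
          Finset.sum_coe_sort A (fun j => ZMod.stdAddChar (-(j * ξ i)) • f j)
      _ = ∑ j : ZMod p, ZMod.stdAddChar (-(j * ξ i)) • f j := by
          apply Finset.sum_subset (Finset.subset_univ A)
          intro j _ hj
          have : f j = 0 := by simpa [hAdef, mem_zmodSupport] using hj
          simp [this]
      _ = 0 := hξi
  obtain ⟨a₀, ha₀⟩ := hA
  have hv := Matrix.eq_zero_of_mulVec_eq_zero hdet hker
  have h1 : f (x (eA ⟨a₀, ha₀⟩)) = 0 := congrFun hv (eA ⟨a₀, ha₀⟩)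
  have h2 : x (eA ⟨a₀, ha₀⟩) = a₀ := by simp [x]
  rw [h2] at h1
  exact ((mem_zmodSupport f a₀).mp ha₀) h1

/-- Dimension count (Tao 2005, proof of the converse): if `|A| + |B| ≥ p + 1` there is a non-zero
`f` supported in `A` with `𝓕 f` supported in `B` (the restricted Fourier matrix
`ℓ²(A) → ℓ²(Bᶜ)` has a kernel since `|Bᶜ| < |A|`). [cite: Tao2005, proof of Theorem 1 (arXiv:math/0308286 §1)] -/
theorem exists_ne_zero_supported_dft_supported (A B : Finset (ZMod p))
    (hAB : p + 1 ≤ A.card + B.card) :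
    ∃ f : ZMod p → ℂ, f ≠ 0 ∧ (∀ x, x ∉ A → f x = 0) ∧ ∀ ξ, ξ ∉ B → ZMod.dft f ξ = 0 := by
  let M : Matrix (Bᶜ : Finset (ZMod p)) A ℂ :=
    Matrix.of fun c a => (ZMod.stdAddChar (-((a : ZMod p) * (c : ZMod p))) : ℂ)
  have hBle : B.card ≤ p := by simpa [ZMod.card] using Finset.card_le_univ B
  have hlt : Module.finrank ℂ ((Bᶜ : Finset (ZMod p)) → ℂ) < Module.finrank ℂ (A → ℂ) := by
    rw [Module.finrank_fintype_fun_eq_card, Module.finrank_fintype_fun_eq_card,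
      Fintype.card_coe, Fintype.card_coe, Finset.card_compl, ZMod.card]
    omega
  have hker := LinearMap.ker_ne_bot_of_finrank_lt (f := Matrix.mulVecLin M) hlt
  obtain ⟨g, hg, hg0⟩ := (Submodule.ne_bot_iff _).mp hker
  set f' : ZMod p → ℂ := fun x => if h : x ∈ A then g ⟨x, h⟩ else 0 with hf'
  have hf'A : ∀ a : A, f' a = g a := fun a => by simp [hf', a.2]
  have hf'out : ∀ x, x ∉ A → f' x = 0 := fun x hx => by simp [hf', hx]
  refine ⟨f', ?_, hf'out, ?_⟩
  · intro h0
    apply hg0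
    funext a
    rw [← hf'A, h0, Pi.zero_apply, Pi.zero_apply]
  · intro ξ hξ
    have hξ' : ξ ∈ Bᶜ := Finset.mem_compl.mpr hξ
    have hgk : (M.mulVec g) ⟨ξ, hξ'⟩ = 0 := by
      rw [LinearMap.mem_ker, Matrix.mulVecLin_apply] at hg
      exact congrFun hg ⟨ξ, hξ'⟩
    rw [ZMod.dft_apply]
    refine Eq.trans ?_ hgk
    simp only [Matrix.mulVec, dotProduct, Matrix.of_apply, M]
    symm
    calc ∑ a : A, ZMod.stdAddChar (-((a : ZMod p) * ξ)) * g a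
        = ∑ a : A, ZMod.stdAddChar (-((a : ZMod p) * ξ)) • f' a := by
          refine Finset.sum_congr rfl fun a _ => ?_
          rw [hf'A, smul_eq_mul]
      _ = ∑ a ∈ A, ZMod.stdAddChar (-(a * ξ)) • f' a :=
          Finset.sum_coe_sort A (fun a => ZMod.stdAddChar (-(a * ξ)) • f' a)
      _ = ∑ j, ZMod.stdAddChar (-(j * ξ)) • f' j := by
          apply Finset.sum_subset (Finset.subset_univ A)
          intro j _ hj
          rw [hf'out j hj, smul_zero]

/-- Equality case of the converse (Tao 2005): if `|A| + |B| = p + 1` there is `f` with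
`supp f = A` and `supp 𝓕f = B` exactly. [cite: Tao2005, proof of Theorem 1 (arXiv:math/0308286 §1)] -/
theorem exists_support_eq_of_card_add_card_eq (A B : Finset (ZMod p))
    (hAB : A.card + B.card = p + 1) :
    ∃ f : ZMod p → ℂ, zmodSupport f = A ∧ zmodSupport (ZMod.dft f) = B := by
  obtain ⟨f, hf0, hfA, hfB⟩ := exists_ne_zero_supported_dft_supported A B hAB.ge
  have h1 := tao2005_card_support_add_card_support_dft f hf0
  have hsubA : zmodSupport f ⊆ A := fun x hx => by
    by_contra h
    exact (mem_zmodSupport f x).mp hx (hfA x h)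
  have hsubB : zmodSupport (ZMod.dft f) ⊆ B := fun ξ hξ => by
    by_contra h
    exact (mem_zmodSupport _ ξ).mp hξ (hfB ξ h)
  have hcA := Finset.card_le_card hsubA
  have hcB := Finset.card_le_card hsubB
  exact ⟨f, Finset.eq_of_subset_of_card_le hsubA (by omega),
    Finset.eq_of_subset_of_card_le hsubB (by omega)⟩

/-- "Generic linear combinations": finitely many non-zero linear functionals on a vector space
over an infinite field have a common point where none of them vanishes (induction, adding a
generic multiple of a witness for the new functional). [folklore] -/
theorem exists_forall_apply_ne_zero {K V ι : Type*} [Field K] [Infinite K] [AddCommGroup V]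
    [Module K V] (s : Finset ι) (ℓ : ι → V →ₗ[K] K) (h : ∀ i ∈ s, ℓ i ≠ 0) :
    ∃ v, ∀ i ∈ s, ℓ i v ≠ 0 := by
  classical
  induction s using Finset.induction_on with
  | empty => exact ⟨0, by simp⟩
  | insert a s ha ih =>
    obtain ⟨v, hv⟩ := ih (fun i hi => h i (Finset.mem_insert_of_mem hi))
    have hℓa : ℓ a ≠ 0 := h a (Finset.mem_insert_self a s)
    obtain ⟨u, hu⟩ : ∃ u, ℓ a u ≠ 0 := by
      by_contra hcon
      apply hℓa
      ext u
      rw [LinearMap.zero_apply]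
      exact not_not.mp (not_exists.mp hcon u)
    obtain ⟨t, ht⟩ :=
      Infinite.exists_notMem_finset ((insert a s).image fun i => -(ℓ i v) / ℓ i u)
    refine ⟨v + t • u, ?_⟩
    intro i hi h0
    rw [map_add, map_smul, smul_eq_mul] at h0
    by_cases hiu : ℓ i u = 0
    · rw [hiu, mul_zero, add_zero] at h0
      rcases Finset.mem_insert.mp hi with rfl | hi'
      · exact hu hiu
      · exact hv i hi' h0
    · apply ht
      refine Finset.mem_image.mpr ⟨i, hi, ?_⟩
      rw [div_eq_iff hiu]
      linear_combination -h0

/-- **Tao 2005, Theorem 1, converse part**: for `A, B ⊆ ℤ/p` with `|A| + |B| ≥ p + 1` there is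
`f` with `supp f = A` and `supp 𝓕f = B` ("generic linear combinations" of the equality-case
functions). [cite: Tao2005, Theorem 1 (arXiv:math/0308286 §1)] -/
theorem tao2005_exists_support_eq (A B : Finset (ZMod p)) (hAB : p + 1 ≤ A.card + B.card) :
    ∃ f : ZMod p → ℂ, zmodSupport f = A ∧ zmodSupport (ZMod.dft f) = B := by
  -- the subspace of functions supported in `A` with transform supported in `B`
  let W : Submodule ℂ (ZMod p → ℂ) :=
    { carrier := {f | (∀ x, x ∉ A → f x = 0) ∧ ∀ ξ, ξ ∉ B → ZMod.dft f ξ = 0}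
      add_mem' := by
        rintro f g ⟨hf1, hf2⟩ ⟨hg1, hg2⟩
        refine ⟨fun x hx => ?_, fun ξ hξ => ?_⟩
        · simp [hf1 x hx, hg1 x hx]
        · rw [map_add, Pi.add_apply, hf2 ξ hξ, hg2 ξ hξ, add_zero]
      zero_mem' := ⟨fun x _ => rfl, fun ξ _ => by simp⟩
      smul_mem' := by
        rintro c f ⟨hf1, hf2⟩
        refine ⟨fun x hx => ?_, fun ξ hξ => ?_⟩
        · simp [hf1 x hx]
        · rw [map_smul, Pi.smul_apply, hf2 ξ hξ, smul_zero] }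
  let evalAt : ZMod p → (W →ₗ[ℂ] ℂ) := fun x => (LinearMap.proj x).comp W.subtype
  let evalDftAt : ZMod p → (W →ₗ[ℂ] ℂ) := fun ξ =>
    (LinearMap.proj ξ).comp ((ZMod.dft (N := p) (E := ℂ)).toLinearMap.comp W.subtype)
  have hevalAt : ∀ x (w : W), evalAt x w = (w : ZMod p → ℂ) x := fun _ _ => rfl
  have hevalDftAt : ∀ ξ (w : W), evalDftAt ξ w = ZMod.dft (w : ZMod p → ℂ) ξ := fun _ _ => rfl
  let ℓ : A ⊕ B → (W →ₗ[ℂ] ℂ) := Sum.elim (fun x => evalAt x) (fun ξ => evalDftAt ξ)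
  have hcardA : A.card ≤ p := by simpa [ZMod.card] using Finset.card_le_univ A
  have hcardB : B.card ≤ p := by simpa [ZMod.card] using Finset.card_le_univ B
  -- each functional is non-zero on `W`, witnessed by an equality-case function
  have hℓ : ∀ i ∈ (Finset.univ : Finset (A ⊕ B)), ℓ i ≠ 0 := by
    rintro (⟨x, hx⟩ | ⟨ξ, hξ⟩) -
    · obtain ⟨B', hB'B, hB'card⟩ :=
        Finset.exists_subset_card_eq (s := B) (n := p + 1 - A.card) (by omega)
      obtain ⟨f, hfA, hfB⟩ := exists_support_eq_of_card_add_card_eq A B' (by omega)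
      have hfW : f ∈ W := by
        refine ⟨fun y hy => ?_, fun η hη => ?_⟩
        · by_contra h
          exact hy (hfA ▸ (mem_zmodSupport f y).mpr h)
        · by_contra h
          exact hη (hB'B (hfB ▸ (mem_zmodSupport _ η).mpr h))
      intro h0
      have happ : ℓ (Sum.inl ⟨x, hx⟩) ⟨f, hfW⟩ = 0 := by
        rw [h0, LinearMap.zero_apply]
      simp only [ℓ, Sum.elim_inl] at happ
      rw [hevalAt] at happ
      exact (mem_zmodSupport f x).mp (hfA ▸ hx) happ
    · obtain ⟨A', hA'A, hA'card⟩ :=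
        Finset.exists_subset_card_eq (s := A) (n := p + 1 - B.card) (by omega)
      obtain ⟨f, hfA, hfB⟩ := exists_support_eq_of_card_add_card_eq A' B (by omega)
      have hfW : f ∈ W := by
        refine ⟨fun y hy => ?_, fun η hη => ?_⟩
        · by_contra h
          exact hy (hA'A (hfA ▸ (mem_zmodSupport f y).mpr h))
        · by_contra h
          exact hη (hfB ▸ (mem_zmodSupport _ η).mpr h)
      intro h0
      have happ : ℓ (Sum.inr ⟨ξ, hξ⟩) ⟨f, hfW⟩ = 0 := by
        rw [h0, LinearMap.zero_apply]
      simp only [ℓ, Sum.elim_inr] at happ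
      rw [hevalDftAt] at happ
      exact (mem_zmodSupport _ ξ).mp (hfB ▸ hξ) happ
  -- hence some `w ∈ W` is missed by no functional
  obtain ⟨w, hw⟩ := exists_forall_apply_ne_zero Finset.univ ℓ hℓ
  refine ⟨(w : ZMod p → ℂ), ?_, ?_⟩
  · ext x
    rw [mem_zmodSupport]
    constructor
    · intro hx0
      by_contra hxA
      exact hx0 (w.2.1 x hxA)
    · intro hxA
      have := hw (Sum.inl ⟨x, hxA⟩) (Finset.mem_univ _)
      simp only [ℓ, Sum.elim_inl] at this
      rwa [hevalAt] at this
  · ext ξ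
    rw [mem_zmodSupport]
    constructor
    · intro hξ0
      by_contra hξB
      exact hξ0 (w.2.2 ξ hξB)
    · intro hξB
      have := hw (Sum.inr ⟨ξ, hξB⟩) (Finset.mem_univ _)
      simp only [ℓ, Sum.elim_inr] at this
      rwa [hevalDftAt] at this

/-- **Tao 2005, Theorem 1** (both directions), discharging the named fact
`tao2005_uncertainty_prime`: Chebotarev's lemma via the Newton factorisation
(`det_primitiveRoot_pow_mul_ne_zero`), the kernel-vector argument, the dimension count and the
generic-linear-combination argument. [cite: Tao2005, Theorem 1 (arXiv:math/0308286 §1)] -/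
theorem tao2005_uncertainty_prime_holds : tao2005_uncertainty_prime := by
  intro p _
  exact ⟨fun f hf => tao2005_card_support_add_card_support_dft f hf,
    fun A B _ _ hAB => tao2005_exists_support_eq A B hAB⟩

end TaoTheorem

end Literature.Analysis.Fourier

end
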